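import Summits.QuantumFields.YangMills.Theorems.PoincareLipschitzWenteTwoPoint
import Literature.Analysis.FunctionSpaces.SobolevDomain
import Mathlib.MeasureTheory.Function.LocallyIntegrable
import Mathlib.Analysis.SpecialFunctions.Sqrt
import HarnessLib

/-!
# Crux `BlockLipschitzL` (stmt-QuantumFields-23533) ∕ `HistoryTailL` (stmt-QuantumFields-19936), LINE 25 «CompactnessTransfer»,
# stub S1″ — the (GAP) socket, ROAD (W) «Wente at 3π», brick (W-TWO-HOLDS, rows form) «DOOR-TWO FROM THE THREE ANALYTIC ROWS»

Cell `ym3-torus` (YM ladder rung R3 = continuum SU(2) Yang–Mills on T³ — a RUNG, NOT Clay: not d = 4, not infinite volume,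
not a mass gap); WIDTH helper seat `ym-ust-19936-w3` g16 (road owner of ROAD (W)); `--supports stmt-QuantumFields-23533`;
THEOREMS ONLY (0 `def`, 0 `sorry`, default heartbeats); imports px22 g8's ✓`…PoincareLipschitzWenteTwoPoint` (the abstract two-point
knit `wente_twoPoint_of_oneCentre_of_inversion` over an admissibility predicate), lit `SobolevDomain`, Mathlib.

THE POINT.  DOOR-TWO (the hypothesis of ✓`…HSystemGapAtThreePiOfDoors.hSystem_energy_zero_of_le_three_pi_of_doorTWO`, text frozen
2026-08-29 as `DOOR-TWO-text.w3g16.txt`) is the SHARP TWO-POINT WENTE BOUND for a scalar configuration `(u; a, b)` on `ℝ²`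
(`Δu = 2 det(∇a, ∇b)` weakly, finite energies, `L²_loc`): `u` a.e. equals a continuous `ū` with `|ū x₀ − ū x₁| ≤ (1∕π)‖∇a‖₂‖∇b‖₂`.
This file derives DOOR-TWO from THREE ROWS typed by other pens, taken here as hypotheses in their exact export shapes:
* `hONE` = w7 g15's (ONE′) `…PoincareLipschitzWenteOneCentre.wente_oneCentre` (one-centre Wente bound with smooth annular averages:
  continuous representative, ball row, and the limit `L` at infinity with `|ū x₀ − L| ≤ π⁻¹‖∇a‖₂‖∇b‖₂`, for SOME annular kernel `Ψ`);
* `hTR` = w4 g16's (W-INV) `…PoincareLipschitzSobolevInversionWente.wenteTriple_comp_inversion` (the triple transports under the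
  planar inversion `EuclideanGeometry.inversion c 1`, pole removed, energies preserved, partners swapped to restore the sign);
* `hDEC` = px22 g8's (W-DEC) `…PoincareLipschitzSobolevPlanarDecay.integrableOn_sq_div_norm_pow_four` (`∫_{‖x−c‖>1} v²∕‖x−c‖⁴ < ∞`
  for every finite-energy `W^{1,2}_loc` function — the removable-pole input, for `u` AND the partners).
KNIT: px22's ✓`wente_twoPoint_of_oneCentre_of_inversion` at the admissibility predicate «`v` heads a triple `(v; a′, b′)` with the
DOOR-TWO rows and `(1∕π)‖∇a′‖₂‖∇b′‖₂ ≤ K`», `K := (1∕π)‖∇a‖₂‖∇b‖₂`: `hONE` gives the one-centre row with constant `≤ K`, `hTR`+`hDEC`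
give inversion-invariance of the class (conformal invariance of the energies; the swap leaves the product unchanged).  When the three
rows land, `doorTWO_holds := doorTWO_of_rows wente_oneCentre (fun c … => wenteTriple_comp_inversion c …) (fun … => integrableOn_sq_div_norm_pow_four …)`.

HONEST SCOPE.  Soft knit over three HYPOTHESIS rows (bricks in flight); nothing of (W-OSC)∕(F′)∕(GAP)∕(TM)∕S1″∕`BlockLipschitzL`∕
`HistoryTailL` is proved unconditionally here.  YM₃ on T³ is rung R3, not Clay; YM gap NOT proved; no summit statement is proved here.

References: H. Brezis, J.-M. Coron, ARMA 89 (1985) [BrezisCoron1985] (App. Lemma A.1, the inversion∕removability step p. 48);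
P. Topping, Comment. Math. Helv. 72 (1997) [Topping1997] (the constant 1∕2π).
-/

set_option autoImplicit false

noncomputable section

open MeasureTheory Set Function Filter Topology TopologicalSpace EuclideanGeometry Metric
open scoped ContDiff BigOperators

namespace Summit.QuantumFields.YangMills.Theorems.PoincareLipschitzWenteTwoPointOfRows

open Literature.Analysis.FunctionSpaces
open Summit.QuantumFields.YangMills.Theorems.PoincareLipschitzWenteTwoPoint

/-- **(W-TWO-HOLDS, rows form) DOOR-TWO — the sharp two-point Wente bound for scalar configurations — from the one-centre row
(w7 g15), the inversion-transport row (w4 g16) and the planar decay row (px22 g8), all taken as hypotheses in their export shapes;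
knit = px22 g8's ✓`wente_twoPoint_of_oneCentre_of_inversion` at the admissibility predicate «heads a finite-energy Wente triple with
`(1∕π)‖∇a′‖₂‖∇b′‖₂ ≤ K`».  [cite: Topping1997, Theorem 1 (constant 1∕2π); BrezisCoron1985, Appendix Lemma A.1 (p. 48, inversion step)] -/
theorem doorTWO_of_rows
    (hONE : ∃ Ψ : ℝ → ℝ, (Continuous Ψ ∧ (∀ t : ℝ, t ≤ 1/4 ∨ 1 ≤ t → Ψ t = 0) ∧
        ∫ z : EuclideanSpace ℝ (Fin 2), Ψ (‖z‖ ^ 2) = Real.pi) ∧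
      ∀ (u a b : EuclideanSpace ℝ (Fin 2) → ℝ) (Gu Ga Gb : EuclideanSpace ℝ (Fin 2) → EuclideanSpace ℝ (Fin 2) →L[ℝ] ℝ),
        HasWeakFDerivOn (⟨univ, isOpen_univ⟩ : Opens (EuclideanSpace ℝ (Fin 2))) volume u Gu →
        HasWeakFDerivOn (⟨univ, isOpen_univ⟩ : Opens (EuclideanSpace ℝ (Fin 2))) volume a Ga →
        HasWeakFDerivOn (⟨univ, isOpen_univ⟩ : Opens (EuclideanSpace ℝ (Fin 2))) volume b Gb →
        LocallyIntegrable (fun y => a y ^ 2) volume → LocallyIntegrable (fun y => b y ^ 2) volume →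
        Integrable (fun y => ∑ k : Fin 2, (Ga y (EuclideanSpace.single k (1:ℝ))) ^ 2) volume →
        Integrable (fun y => ∑ k : Fin 2, (Gb y (EuclideanSpace.single k (1:ℝ))) ^ 2) volume →
        (∀ η : EuclideanSpace ℝ (Fin 2) → ℝ, ContDiff ℝ ∞ η → HasCompactSupport η →
          -(∫ y, ∑ k : Fin 2, fderiv ℝ η y (EuclideanSpace.single k (1:ℝ)) * Gu y (EuclideanSpace.single k (1:ℝ))) =
            2 * ∫ y, η y * (Ga y (EuclideanSpace.single 0 (1:ℝ)) * Gb y (EuclideanSpace.single 1 (1:ℝ)) -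
              Ga y (EuclideanSpace.single 1 (1:ℝ)) * Gb y (EuclideanSpace.single 0 (1:ℝ)))) →
        ∃ ū : EuclideanSpace ℝ (Fin 2) → ℝ, Continuous ū ∧ ū =ᵐ[volume] u ∧
          (∀ (x₀ : EuclideanSpace ℝ (Fin 2)) (r : ℝ), 0 < r →
            |ū x₀ - (Real.pi * r ^ 2)⁻¹ * ∫ y, Ψ (‖y - x₀‖ ^ 2 / r ^ 2) * u y| ≤
              (Real.pi)⁻¹ * Real.sqrt (∫ y in ball x₀ r, ∑ k : Fin 2, (Ga y (EuclideanSpace.single k (1:ℝ))) ^ 2) *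
                Real.sqrt (∫ y in ball x₀ r, ∑ k : Fin 2, (Gb y (EuclideanSpace.single k (1:ℝ))) ^ 2)) ∧
          ∀ x₀ : EuclideanSpace ℝ (Fin 2), ∃ L : ℝ,
            Tendsto (fun R : ℝ => (Real.pi * R ^ 2)⁻¹ * ∫ y, Ψ (‖y - x₀‖ ^ 2 / R ^ 2) * ū y) atTop (𝓝 L) ∧
            |ū x₀ - L| ≤ (Real.pi)⁻¹ * Real.sqrt (∫ y, ∑ k : Fin 2, (Ga y (EuclideanSpace.single k (1:ℝ))) ^ 2) *
              Real.sqrt (∫ y, ∑ k : Fin 2, (Gb y (EuclideanSpace.single k (1:ℝ))) ^ 2))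
    (hTR : ∀ (c : EuclideanSpace ℝ (Fin 2)) {u a b : EuclideanSpace ℝ (Fin 2) → ℝ}
      {Gu Ga Gb : EuclideanSpace ℝ (Fin 2) → EuclideanSpace ℝ (Fin 2) →L[ℝ] ℝ},
      HasWeakFDerivOn (⟨univ, isOpen_univ⟩ : Opens (EuclideanSpace ℝ (Fin 2))) volume u Gu →
      HasWeakFDerivOn (⟨univ, isOpen_univ⟩ : Opens (EuclideanSpace ℝ (Fin 2))) volume a Ga →
      HasWeakFDerivOn (⟨univ, isOpen_univ⟩ : Opens (EuclideanSpace ℝ (Fin 2))) volume b Gb →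
      LocallyIntegrable (fun y => u y ^ 2) volume → LocallyIntegrable (fun y => a y ^ 2) volume →
      LocallyIntegrable (fun y => b y ^ 2) volume →
      Integrable (fun y => ∑ k : Fin 2, (Gu y (EuclideanSpace.single k 1)) ^ 2) →
      Integrable (fun y => ∑ k : Fin 2, (Ga y (EuclideanSpace.single k 1)) ^ 2) →
      Integrable (fun y => ∑ k : Fin 2, (Gb y (EuclideanSpace.single k 1)) ^ 2) →
      (∀ η : EuclideanSpace ℝ (Fin 2) → ℝ, ContDiff ℝ ∞ η → HasCompactSupport η →
        -(∫ y, ∑ k : Fin 2, fderiv ℝ η y (EuclideanSpace.single k 1) * Gu y (EuclideanSpace.single k 1)) =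
          2 * ∫ y, η y * (Ga y (EuclideanSpace.single 0 1) * Gb y (EuclideanSpace.single 1 1) -
            Ga y (EuclideanSpace.single 1 1) * Gb y (EuclideanSpace.single 0 1))) →
      IntegrableOn (fun x => u x ^ 2 * ((‖x - c‖ ^ 2)⁻¹) ^ 2) {x | 1 < dist x c} →
      IntegrableOn (fun x => a x ^ 2 * ((‖x - c‖ ^ 2)⁻¹) ^ 2) {x | 1 < dist x c} →
      IntegrableOn (fun x => b x ^ 2 * ((‖x - c‖ ^ 2)⁻¹) ^ 2) {x | 1 < dist x c} →
      HasWeakFDerivOn (⟨univ, isOpen_univ⟩ : Opens (EuclideanSpace ℝ (Fin 2))) volume (fun y => u (inversion c 1 y))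
          (fun y => (Gu (inversion c 1 y)).comp (fderiv ℝ (inversion c 1) y)) ∧
        HasWeakFDerivOn (⟨univ, isOpen_univ⟩ : Opens (EuclideanSpace ℝ (Fin 2))) volume (fun y => b (inversion c 1 y))
          (fun y => (Gb (inversion c 1 y)).comp (fderiv ℝ (inversion c 1) y)) ∧
        HasWeakFDerivOn (⟨univ, isOpen_univ⟩ : Opens (EuclideanSpace ℝ (Fin 2))) volume (fun y => a (inversion c 1 y))
          (fun y => (Ga (inversion c 1 y)).comp (fderiv ℝ (inversion c 1) y)) ∧
        LocallyIntegrable (fun y => (u (inversion c 1 y)) ^ 2) volume ∧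
        LocallyIntegrable (fun y => (b (inversion c 1 y)) ^ 2) volume ∧
        LocallyIntegrable (fun y => (a (inversion c 1 y)) ^ 2) volume ∧
        Integrable (fun y => ∑ k : Fin 2,
          ((Gu (inversion c 1 y)).comp (fderiv ℝ (inversion c 1) y) (EuclideanSpace.single k 1)) ^ 2) ∧
        Integrable (fun y => ∑ k : Fin 2,
          ((Gb (inversion c 1 y)).comp (fderiv ℝ (inversion c 1) y) (EuclideanSpace.single k 1)) ^ 2) ∧
        Integrable (fun y => ∑ k : Fin 2,
          ((Ga (inversion c 1 y)).comp (fderiv ℝ (inversion c 1) y) (EuclideanSpace.single k 1)) ^ 2) ∧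
        (∫ y, ∑ k : Fin 2, ((Gu (inversion c 1 y)).comp (fderiv ℝ (inversion c 1) y) (EuclideanSpace.single k 1)) ^ 2) =
          ∫ x, ∑ k : Fin 2, (Gu x (EuclideanSpace.single k 1)) ^ 2 ∧
        (∫ y, ∑ k : Fin 2, ((Gb (inversion c 1 y)).comp (fderiv ℝ (inversion c 1) y) (EuclideanSpace.single k 1)) ^ 2) =
          ∫ x, ∑ k : Fin 2, (Gb x (EuclideanSpace.single k 1)) ^ 2 ∧
        (∫ y, ∑ k : Fin 2, ((Ga (inversion c 1 y)).comp (fderiv ℝ (inversion c 1) y) (EuclideanSpace.single k 1)) ^ 2) =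
          ∫ x, ∑ k : Fin 2, (Ga x (EuclideanSpace.single k 1)) ^ 2 ∧
        ∀ η : EuclideanSpace ℝ (Fin 2) → ℝ, ContDiff ℝ ∞ η → HasCompactSupport η →
          -(∫ y, ∑ k : Fin 2, fderiv ℝ η y (EuclideanSpace.single k 1) *
              (Gu (inversion c 1 y)).comp (fderiv ℝ (inversion c 1) y) (EuclideanSpace.single k 1)) =
            2 * ∫ y, η y *
              ((Gb (inversion c 1 y)).comp (fderiv ℝ (inversion c 1) y) (EuclideanSpace.single 0 1) *
                  (Ga (inversion c 1 y)).comp (fderiv ℝ (inversion c 1) y) (EuclideanSpace.single 1 1) -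
                (Gb (inversion c 1 y)).comp (fderiv ℝ (inversion c 1) y) (EuclideanSpace.single 1 1) *
                  (Ga (inversion c 1 y)).comp (fderiv ℝ (inversion c 1) y) (EuclideanSpace.single 0 1)))
    (hDEC : ∀ {v : EuclideanSpace ℝ (Fin 2) → ℝ} {Gv : EuclideanSpace ℝ (Fin 2) → EuclideanSpace ℝ (Fin 2) →L[ℝ] ℝ},
      HasWeakFDerivOn (⟨univ, isOpen_univ⟩ : Opens (EuclideanSpace ℝ (Fin 2))) volume v Gv →
      LocallyIntegrable (fun y => v y ^ 2) volume →
      Integrable (fun y => ∑ k : Fin 2, (Gv y (EuclideanSpace.single k (1:ℝ))) ^ 2) volume →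
      ∀ c : EuclideanSpace ℝ (Fin 2), IntegrableOn (fun x => v x ^ 2 * ((‖x - c‖ ^ 2)⁻¹) ^ 2) {x | 1 < dist x c}) :
    ∀ (u a b : EuclideanSpace ℝ (Fin 2) → ℝ)
      (Gu Ga Gb : EuclideanSpace ℝ (Fin 2) → (EuclideanSpace ℝ (Fin 2) →L[ℝ] ℝ)),
      HasWeakFDerivOn ⟨Set.univ, isOpen_univ⟩ volume u Gu →
      HasWeakFDerivOn ⟨Set.univ, isOpen_univ⟩ volume a Ga →
      HasWeakFDerivOn ⟨Set.univ, isOpen_univ⟩ volume b Gb →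
      LocallyIntegrable (fun y => u y ^ 2) volume →
      LocallyIntegrable (fun y => a y ^ 2) volume →
      LocallyIntegrable (fun y => b y ^ 2) volume →
      Integrable (fun y => ∑ k : Fin 2, (Gu y (EuclideanSpace.single k (1:ℝ))) ^ 2) volume →
      Integrable (fun y => ∑ k : Fin 2, (Ga y (EuclideanSpace.single k (1:ℝ))) ^ 2) volume →
      Integrable (fun y => ∑ k : Fin 2, (Gb y (EuclideanSpace.single k (1:ℝ))) ^ 2) volume →
      (∀ η : EuclideanSpace ℝ (Fin 2) → ℝ, ContDiff ℝ ∞ η → HasCompactSupport η →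
        -(∫ y, ∑ k : Fin 2, fderiv ℝ η y (EuclideanSpace.single k (1:ℝ)) * Gu y (EuclideanSpace.single k (1:ℝ))) =
          2 * ∫ y, η y * (Ga y (EuclideanSpace.single 0 (1:ℝ)) * Gb y (EuclideanSpace.single 1 (1:ℝ)) -
            Ga y (EuclideanSpace.single 1 (1:ℝ)) * Gb y (EuclideanSpace.single 0 (1:ℝ)))) →
      ∃ ū : EuclideanSpace ℝ (Fin 2) → ℝ, Continuous ū ∧ ū =ᵐ[volume] u ∧
        ∀ x₀ x₁, |ū x₀ - ū x₁| ≤ 1 / Real.pi *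
          (Real.sqrt (∫ y, ∑ k : Fin 2, (Ga y (EuclideanSpace.single k (1:ℝ))) ^ 2) *
           Real.sqrt (∫ y, ∑ k : Fin 2, (Gb y (EuclideanSpace.single k (1:ℝ))) ^ 2)) := by
  obtain ⟨Ψ, ⟨hΨc, hΨ0, hΨπ⟩, hONE'⟩ := hONE
  intro u a b Gu Ga Gb hu ha hb hu2 ha2 hb2 hGu hGa hGb hEq
  -- the admissibility predicate: heads of finite-energy Wente triples with constant ≤ K
  refine wente_twoPoint_of_oneCentre_of_inversion Ψ hΨc hΨ0 hΨπ
    (K := 1 / Real.pi * (Real.sqrt (∫ y, ∑ k : Fin 2, (Ga y (EuclideanSpace.single k (1:ℝ))) ^ 2) *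
      Real.sqrt (∫ y, ∑ k : Fin 2, (Gb y (EuclideanSpace.single k (1:ℝ))) ^ 2)))
    (fun v => ∃ (a' b' : EuclideanSpace ℝ (Fin 2) → ℝ) (Gv Ga' Gb' : EuclideanSpace ℝ (Fin 2) → EuclideanSpace ℝ (Fin 2) →L[ℝ] ℝ),
      HasWeakFDerivOn (⟨univ, isOpen_univ⟩ : Opens (EuclideanSpace ℝ (Fin 2))) volume v Gv ∧
      HasWeakFDerivOn (⟨univ, isOpen_univ⟩ : Opens (EuclideanSpace ℝ (Fin 2))) volume a' Ga' ∧
      HasWeakFDerivOn (⟨univ, isOpen_univ⟩ : Opens (EuclideanSpace ℝ (Fin 2))) volume b' Gb' ∧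
      LocallyIntegrable (fun y => v y ^ 2) volume ∧ LocallyIntegrable (fun y => a' y ^ 2) volume ∧
      LocallyIntegrable (fun y => b' y ^ 2) volume ∧
      Integrable (fun y => ∑ k : Fin 2, (Gv y (EuclideanSpace.single k (1:ℝ))) ^ 2) volume ∧
      Integrable (fun y => ∑ k : Fin 2, (Ga' y (EuclideanSpace.single k (1:ℝ))) ^ 2) volume ∧
      Integrable (fun y => ∑ k : Fin 2, (Gb' y (EuclideanSpace.single k (1:ℝ))) ^ 2) volume ∧
      (∀ η : EuclideanSpace ℝ (Fin 2) → ℝ, ContDiff ℝ ∞ η → HasCompactSupport η →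
        -(∫ y, ∑ k : Fin 2, fderiv ℝ η y (EuclideanSpace.single k (1:ℝ)) * Gv y (EuclideanSpace.single k (1:ℝ))) =
          2 * ∫ y, η y * (Ga' y (EuclideanSpace.single 0 (1:ℝ)) * Gb' y (EuclideanSpace.single 1 (1:ℝ)) -
            Ga' y (EuclideanSpace.single 1 (1:ℝ)) * Gb' y (EuclideanSpace.single 0 (1:ℝ)))) ∧
      1 / Real.pi * (Real.sqrt (∫ y, ∑ k : Fin 2, (Ga' y (EuclideanSpace.single k (1:ℝ))) ^ 2) *
        Real.sqrt (∫ y, ∑ k : Fin 2, (Gb' y (EuclideanSpace.single k (1:ℝ))) ^ 2)) ≤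
      1 / Real.pi * (Real.sqrt (∫ y, ∑ k : Fin 2, (Ga y (EuclideanSpace.single k (1:ℝ))) ^ 2) *
        Real.sqrt (∫ y, ∑ k : Fin 2, (Gb y (EuclideanSpace.single k (1:ℝ))) ^ 2)))
    ?_ ?_ ⟨a, b, Gu, Ga, Gb, hu, ha, hb, hu2, ha2, hb2, hGu, hGa, hGb, hEq, le_rfl⟩
  · -- (ONE): the one-centre row for every admissible head, with constant ≤ K
    rintro v ⟨a', b', Gv, Ga', Gb', hv, ha', hb', hv2, ha2', hb2', hGv, hGa', hGb', hEq', hK'⟩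
    obtain ⟨w, hwc, hwae, -, hlim⟩ := hONE' v a' b' Gv Ga' Gb' hv ha' hb' ha2' hb2' hGa' hGb' hEq'
    refine ⟨w, hwc, hwae, fun x₀ => ?_⟩
    obtain ⟨L, hL, hbd⟩ := hlim x₀
    refine ⟨L, hL, hbd.trans ?_⟩
    rw [mul_assoc, ← one_div]
    exact hK'
  · -- (INV): the class is inversion-invariant about every centre (transport + decay; swap the partners)
    rintro v x₁ ⟨a', b', Gv, Ga', Gb', hv, ha', hb', hv2, ha2', hb2', hGv, hGa', hGb', hEq', hK'⟩
    have hdv := hDEC hv hv2 hGv x₁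
    have hda := hDEC ha' ha2' hGa' x₁
    have hdb := hDEC hb' hb2' hGb' x₁
    obtain ⟨hv', hb'', ha'', hv2', hb2'', ha2'', hGv', hGb'', hGa'', -, eGb, eGa, hEq''⟩ :=
      hTR x₁ hv ha' hb' hv2 ha2' hb2' hGv hGa' hGb' hEq' hdv hda hdb
    refine ⟨fun y => b' (inversion x₁ 1 y), fun y => a' (inversion x₁ 1 y),
      fun y => (Gv (inversion x₁ 1 y)).comp (fderiv ℝ (inversion x₁ 1) y),
      fun y => (Gb' (inversion x₁ 1 y)).comp (fderiv ℝ (inversion x₁ 1) y),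
      fun y => (Ga' (inversion x₁ 1 y)).comp (fderiv ℝ (inversion x₁ 1) y),
      hv', hb'', ha'', hv2', hb2'', ha2'', hGv', hGb'', hGa'', hEq'', ?_⟩
    rw [eGb, eGa, mul_comm (Real.sqrt _) (Real.sqrt _)]
    exact hK'

end Summit.QuantumFields.YangMills.Theorems.PoincareLipschitzWenteTwoPointOfRows

end
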